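import Literature.NumberTheory.Irrationality.LaiYu2020.AuxiliaryFunctionProperties
import Literature.NumberTheory.Transcendental.BallRivoalLinearForms
import Literature.NumberTheory.Irrationality.DirichletLValues.LinearIndependence
import HarnessLib

/-!
# Lai–Yu 2020, Lemma 2.5 (linear forms in Hurwitz zeta values) — proofs

Topic `Literature/NumberTheory/Irrationality/LaiYu2020`. Companion ("Proofs") file for
L. Lai, P. Yu, *A note on the number of irrational odd zeta values*, Compositio Math. **156** (2020)
1699–1717 = arXiv:1911.08458 [LaiYu2020], §2 (arXiv text p. 5):

> «For all `θ ∈ 𝓕_B`, we define `r_{n,θ} = ∑_{m=1}^{∞} R_n(m+θ)`. … The following lemma is the same as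
> [FSZ2019] (for a proof, see therein): **Lemma 2.5** (linear forms). For all `θ ∈ 𝓕_B`, we have
> `r_{n,θ} = ρ_{0,θ} + ∑_{3 ≤ i ≤ s, i odd} ρ_i ζ(i, θ)`, where the rational coefficient
> `ρ_i = ∑_{k=0}^{n} a_{i,k}` … does not depend on `θ ∈ 𝓕_B`, and
> `ρ_{0,θ} = −∑_{k=0}^{n} ∑_{ℓ=0}^{k} ∑_{i=1}^{s} a_{i,k}/(ℓ+θ)^i`.» — with, before it, «(2) … since the
> partial fractional expansion for `R_n(t)` is unique, we derive that `(−1)^i a_{i,k} = −a_{i,n−k}`»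
> and «(1) `deg R_n ≤ −2`».

We PROVE Lemma 2.5 (theorems only, no definitions, no named facts; sorry-free) by transplanting the
tree's proof of [FSZ2019, Lemma 1] (`FischlerSprangZudilin2019/LinearForms.lean`, which is tied to the
FSZ function) to an ENGINE about partial-fraction data alone, and feeding it with the Lai–Yu function:

* `hasSum_pfEval_shift` — the engine: for data `c` (poles `−1,…,−(n+1)`, orders `≤ s+1`, tree
  convention `BallRivoal.pfEval`) with `∑_k c_{0,k} = 0` and `∑_k c_{o,k} = 0` for odd `o ≤ s` (`s` odd),
  and any rational `α > 0`: `∑_{m ≥ 0} pf(m + α) = ρ₀(α) + ∑_{3 ≤ i ≤ s, odd} ρ_i ζ(i, α)`;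
* for `R_n` of `AuxiliaryFunction.lean` (`r = u/v`, `n = vm`): partial-fraction data exist
  (`exists_pf_data`, from `exists_partialFraction`), are antisymmetric under `k ↦ n−k`
  (`pf_symm`, from `R_reflect` and the tree's uniqueness `BallRivoal.pf_unique`), hence
  `∑_k a_{i,k} = 0` for even `i` (`pf_sum_eq_zero_of_odd`), and `∑_k a_{1,k} = 0` from
  `deg R_n ≤ −2` (`pf_sum_zero_eq_zero`, via the decay `|R_n(u)| ≤ C/u²`, `abs_R_le`);
* `lemma25` — **Lemma 2.5** for every `θ ∈ 𝓕_B` (as a `HasSum` over `m ≥ 0` of `R_n(m+1+θ)`).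

## References

* [LaiYu2020] L. Lai, P. Yu, Compositio Math. 156 (2020) 1699–1717, §2 Lemma 2.5 and properties (1), (2).
* [FischlerSprangZudilin2019] S. Fischler, J. Sprang, W. Zudilin, Compositio Math. 155 (2019), §2 Lemma 1
  (the proof transplanted here; tree: `FischlerSprangZudilin2019.lemma1`).
-/

noncomputable section

open Finset Filter Polynomial

namespace Literature.NumberTheory.Irrationality.LaiYu2020

open _root_.Topology
open Literature.NumberTheory.Transcendental.BallRivoal (pfEval pf_unique pfEval_reflect pfEval_add
  tendsto_mul_pfEval)
open Literature.NumberTheory.Irrationality.DirichletLValues (hurwitzValue)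

/-! ### Hurwitz-series helpers (as in the tree's FSZ file) -/

/-- Summability of `∑_{n ≥ 0} (n+a)^{-i}` for `i ≥ 2`, `a > 0`. [folklore] -/
private theorem summable_one_div_nat_add_pow {a : ℝ} (ha : 0 < a) {i : ℕ} (hi : 2 ≤ i) :
    Summable (fun n : ℕ => 1 / ((n : ℝ) + a) ^ i) := by
  have h := (Real.summable_one_div_nat_add_rpow a i).2 (by exact_mod_cast hi)
  refine h.congr fun n => ?_
  rw [abs_of_pos (by positivity), Real.rpow_natCast]

/-- `∑_{m ≥ 0} (m + p + 1 + a)^{-i} = ζ(i, a) − ∑_{ℓ ≤ p} (ℓ + a)^{-i}`. [folklore] -/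
private theorem hasSum_one_div_pow_hurwitz_shift {a : ℝ} (ha : 0 < a) {i : ℕ} (hi : 2 ≤ i) (p : ℕ) :
    HasSum (fun m : ℕ => 1 / ((m : ℝ) + p + 1 + a) ^ i)
      (hurwitzValue i a - ∑ ℓ ∈ range (p + 1), 1 / ((ℓ : ℝ) + a) ^ i) := by
  have hs := summable_one_div_nat_add_pow ha hi
  have h := (hasSum_nat_add_iff' (f := fun n : ℕ => 1 / ((n : ℝ) + a) ^ i) (p + 1)).2 hs.hasSum
  rw [hurwitzValue]
  refine h.congr_fun fun m => ?_
  push_cast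
  ring_nf

/-- The telescoping sum `∑_{m ≥ 0} (1/(m+b) − 1/(m+b+p)) = ∑_{ℓ < p} 1/(ℓ+b)` (`b > 0`). [folklore] -/
private theorem hasSum_telescope_shift {b : ℝ} (hb : 0 < b) (p : ℕ) :
    HasSum (fun m : ℕ => 1 / ((m : ℝ) + b) - 1 / ((m : ℝ) + b + p)) (∑ ℓ ∈ range p, 1 / ((ℓ : ℝ) + b)) := by
  set g : ℕ → ℝ := fun m => 1 / ((m : ℝ) + b) with hg
  have hnn : ∀ m : ℕ, 0 ≤ 1 / ((m : ℝ) + b) - 1 / ((m : ℝ) + b + p) := by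
    intro m
    rw [sub_nonneg]
    exact one_div_le_one_div_of_le (by positivity) (by
      have : (0 : ℝ) ≤ p := by positivity
      linarith)
  rw [hasSum_iff_tendsto_nat_of_nonneg hnn]
  have hpart : ∀ M : ℕ, ∑ m ∈ range M, (1 / ((m : ℝ) + b) - 1 / ((m : ℝ) + b + p)) =
      ∑ ℓ ∈ range p, g ℓ - ∑ ℓ ∈ range p, g (M + ℓ) := by
    intro M
    have h1 := sum_range_add g M p
    have h2 := sum_range_add g p M
    rw [add_comm p M] at h2
    have h3 : ∑ m ∈ range M, (1 / ((m : ℝ) + b) - 1 / ((m : ℝ) + b + p)) =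
        ∑ m ∈ range M, g m - ∑ m ∈ range M, g (p + m) := by
      rw [← sum_sub_distrib]
      refine sum_congr rfl fun m _ => ?_
      simp only [hg]
      push_cast
      ring_nf
    rw [h3]
    linarith
  simp_rw [hpart]
  have hlim : Tendsto (fun M : ℕ => ∑ ℓ ∈ range p, g (M + ℓ)) atTop (𝓝 0) := by
    rw [show (0 : ℝ) = ∑ ℓ ∈ range p, (0 : ℝ) by simp]
    refine tendsto_finsetSum _ fun ℓ _ => ?_
    have h1 : Tendsto (fun M : ℕ => (M : ℝ) + ℓ + b) atTop atTop :=
      tendsto_atTop_add_const_right _ _ (tendsto_atTop_add_const_right _ _ tendsto_natCast_atTop_atTop)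
    have hb' : Tendsto (fun M : ℕ => 1 / ((M : ℝ) + ℓ + b)) atTop (𝓝 0) := by
      simp_rw [one_div]
      exact tendsto_inv_atTop_zero.comp h1
    refine hb'.congr fun M => ?_
    simp only [hg]
    push_cast
    ring_nf
  have := (tendsto_const_nhds (x := ∑ ℓ ∈ range p, g ℓ)).sub hlim
  rw [sub_zero] at this
  exact this

/-! ### The engine: summing partial-fraction data along `m + α` -/

/-- **The Fischler–Sprang–Zudilin summation, for partial-fraction data alone**: if
`∑_k c_{0,k} = 0` and `∑_k c_{o,k} = 0` for all odd `o ≤ s` (`s` odd), then for every rational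
`α > 0`, `∑_{m ≥ 0} ∑_{k,o} c_{o,k}/(m+α+k+1)^{o+1} = ρ₀(α) + ∑_{3 ≤ i ≤ s, i odd} ρ_i ζ(i, α)` with
`ρ_i = ∑_k c_{i−1,k}` and `ρ₀(α) = −∑_k ∑_{ℓ ≤ k} ∑_{o ≤ s} c_{o,k}/(ℓ+α)^{o+1}`.
[cite: LaiYu2020, Lemma 2.5 ("the same as [FSZ2019]")] -/
theorem hasSum_pfEval_shift {n s : ℕ} (hs : Odd s) {c : ℕ → ℕ → ℚ}
    (hz : ∑ p ∈ range (n + 1), c 0 p = 0)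
    (hodd : ∀ o : ℕ, o ≤ s → Odd o → ∑ p ∈ range (n + 1), c o p = 0)
    {α : ℚ} (hα : 0 < α) :
    HasSum (fun m : ℕ => (pfEval n (s + 1) c ((m : ℚ) + α) : ℝ))
      (((-∑ k ∈ range (n + 1), ∑ ℓ ∈ range (k + 1), ∑ o ∈ range (s + 1),
          c o k / ((ℓ : ℚ) + α) ^ (o + 1) : ℚ) : ℝ) +
        ∑ i ∈ (Icc 3 s).filter Odd,
          ((∑ k ∈ range (n + 1), c (i - 1) k : ℚ) : ℝ) * hurwitzValue i (α : ℝ)) := by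
  set a : ℝ := (α : ℝ) with haα
  have ha0 : 0 < a := by rw [haα]; exact_mod_cast hα
  have hzR : ∑ p ∈ range (n + 1), (c 0 p : ℝ) = 0 := by exact_mod_cast hz
  -- Step 1: the summand, expanded and with the order-one terms telescoped
  have hterm : ∀ m : ℕ, (pfEval n (s + 1) c ((m : ℚ) + α) : ℝ) =
      ∑ p ∈ range (n + 1), (∑ o ∈ range s,
          (c (o + 1) p : ℝ) * (1 / ((m : ℝ) + p + 1 + a) ^ (o + 2)) +
        -(c 0 p : ℝ) * (1 / ((m : ℝ) + (1 + a)) - 1 / ((m : ℝ) + (1 + a) + p))) := by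
    intro m
    rw [pfEval]
    push_cast
    have h0 : ∑ p ∈ range (n + 1), (c 0 p : ℝ) * (1 / ((m : ℝ) + (1 + a))) = 0 := by
      rw [← sum_mul, hzR, zero_mul]
    rw [← sub_zero (∑ p ∈ range (n + 1), ∑ o ∈ range (s + 1), _), ← h0, ← sum_sub_distrib]
    refine sum_congr rfl fun p _ => ?_
    rw [sum_range_succ']
    rw [haα]
    ring_nf
  simp_rw [hterm]
  -- Step 2: sum over `m`, term by term
  have hsum : HasSum (fun m : ℕ => ∑ p ∈ range (n + 1), (∑ o ∈ range s,
          (c (o + 1) p : ℝ) * (1 / ((m : ℝ) + p + 1 + a) ^ (o + 2)) +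
        -(c 0 p : ℝ) * (1 / ((m : ℝ) + (1 + a)) - 1 / ((m : ℝ) + (1 + a) + p))))
      (∑ p ∈ range (n + 1), (∑ o ∈ range s,
          (c (o + 1) p : ℝ) * (hurwitzValue (o + 2) a - ∑ ℓ ∈ range (p + 1), 1 / ((ℓ : ℝ) + a) ^ (o + 2)) +
        -(c 0 p : ℝ) * ∑ ℓ ∈ range p, 1 / ((ℓ : ℝ) + (1 + a)))) := by
    refine hasSum_sum fun p _ => HasSum.add (hasSum_sum fun o _ => ?_) ?_
    · exact (hasSum_one_div_pow_hurwitz_shift ha0 (by omega) p).mul_left _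
    · exact (hasSum_telescope_shift (by positivity : (0 : ℝ) < 1 + a) p).mul_left _
  convert hsum using 1
  -- Step 3: identification of the value
  have hrho0 : (((-∑ k ∈ range (n + 1), ∑ ℓ ∈ range (k + 1), ∑ o ∈ range (s + 1),
          c o k / ((ℓ : ℚ) + α) ^ (o + 1) : ℚ) : ℝ)) =
      -∑ p ∈ range (n + 1), ((∑ o ∈ range s,
          (c (o + 1) p : ℝ) * ∑ ℓ ∈ range (p + 1), 1 / ((ℓ : ℝ) + a) ^ (o + 2)) +
        (c 0 p : ℝ) * ∑ ℓ ∈ range p, 1 / ((ℓ : ℝ) + (1 + a))) := by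
    have h0 : ∑ p ∈ range (n + 1), (c 0 p : ℝ) * (1 / a) = 0 := by
      rw [← sum_mul, hzR, zero_mul]
    push_cast
    rw [← haα, neg_inj, ← add_zero (∑ p ∈ range (n + 1), (_ + _)), ← h0, ← sum_add_distrib]
    refine sum_congr rfl fun p _ => ?_
    rw [sum_comm, sum_range_succ', sum_range_succ' (fun ℓ => (c 0 p : ℝ) / ((ℓ : ℝ) + a) ^ (0 + 1))]
    simp only [mul_sum]
    have e1 : ∀ o ∈ range s, ∑ ℓ ∈ range (p + 1), (c (o + 1) p : ℝ) / ((ℓ : ℝ) + a) ^ (o + 1 + 1) =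
        ∑ ℓ ∈ range (p + 1), (c (o + 1) p : ℝ) * (1 / ((ℓ : ℝ) + a) ^ (o + 2)) :=
      fun o _ => sum_congr rfl fun ℓ _ => by ring
    have e2 : ∑ ℓ ∈ range p, (c 0 p : ℝ) / (((ℓ + 1 : ℕ) : ℝ) + a) ^ (0 + 1) =
        ∑ ℓ ∈ range p, (c 0 p : ℝ) * (1 / ((ℓ : ℝ) + (1 + a))) :=
      sum_congr rfl fun ℓ _ => by push_cast; ring
    rw [sum_congr rfl e1, e2]
    push_cast
    ring
  have hzeta : ∑ i ∈ (Icc 3 s).filter Odd,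
      ((∑ k ∈ range (n + 1), c (i - 1) k : ℚ) : ℝ) * hurwitzValue i a =
      ∑ p ∈ range (n + 1), ∑ o ∈ range s, (c (o + 1) p : ℝ) * hurwitzValue (o + 2) a := by
    rw [sum_comm]
    have h1 : ∑ o ∈ range s, ∑ p ∈ range (n + 1), (c (o + 1) p : ℝ) * hurwitzValue (o + 2) a =
        ∑ i ∈ Ico 2 (s + 2), ((∑ k ∈ range (n + 1), c (i - 1) k : ℚ) : ℝ) * hurwitzValue i a := by
      rw [sum_Ico_eq_sum_range, show s + 2 - 2 = s by omega]
      refine sum_congr rfl fun o _ => ?_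
      rw [show 2 + o - 1 = o + 1 by omega, add_comm 2 o]
      push_cast
      rw [sum_mul]
    rw [h1]
    have h2 : (Icc 3 s).filter Odd = (Ico 2 (s + 2)).filter Odd := by
      ext i
      simp only [mem_filter, mem_Icc, mem_Ico]
      constructor
      · rintro ⟨⟨h3, h4⟩, ho⟩; exact ⟨⟨by omega, by omega⟩, ho⟩
      · rintro ⟨⟨h3, h4⟩, ho⟩
        have h5 := Nat.odd_iff.1 ho
        have h6 := Nat.odd_iff.1 hs
        refine ⟨⟨by omega, by omega⟩, ho⟩
    rw [h2, sum_filter_of_ne]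
    intro i hi hne
    by_contra hoddi
    apply hne
    have hev : Odd (i - 1) := by
      have h5 := (mem_Ico.1 hi).1
      rcases Nat.even_or_odd i with h | h
      · have := Nat.even_iff.1 h
        exact Nat.odd_iff.2 (by omega)
      · exact absurd h hoddi
    rw [show ∑ k ∈ range (n + 1), c (i - 1) k = 0 from
      hodd (i - 1) (by have := (mem_Ico.1 hi).2; omega) hev]
    simp
  rw [hrho0, hzeta, neg_add_eq_sub, ← sum_sub_distrib]
  refine sum_congr rfl fun p _ => ?_
  simp only [mul_sub, sum_sub_distrib]
  ring

/-! ### Partial-fraction data of the Lai–Yu function -/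

/-- **Partial-fraction data of `R_n`** in the tree's convention: `c_{o,p} = a_{o+1,p}`,
`∑_{p,o} c_{o,p}/(t+p+1)^{o+1} = R_n(t+1)` off the poles (from the expansion (2.3)).
[cite: LaiYu2020, §2 eq. (2.3)] -/
theorem exists_pf_data (u v s : ℕ) (B : ℝ) (m : ℕ)
    (hdeg : 1 + (2 * u + v) * m * (zeroSet_finite B).toFinset.card < (s + 1) * (v * m + 1)) :
    ∃ c : ℕ → ℕ → ℚ, ∀ t : ℚ, (∀ p : ℕ, p ≤ v * m → t + p + 1 ≠ 0) →
      pfEval (v * m) (s + 1) c t = R u v s B m (t + 1) := by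
  obtain ⟨a, ha⟩ := exists_partialFraction u v s B m hdeg
  refine ⟨fun o p => a (o + 1) p, fun t ht => ?_⟩
  have ht' : ∀ j ∈ range (v * m + 1), t + 1 + (j : ℚ) ≠ 0 := by
    intro j hj h
    exact ht j (by have := mem_range.1 hj; omega) (by linarith)
  rw [ha (t + 1) ht', pfEval]
  refine sum_congr rfl fun p _ => ?_
  rw [show Icc 1 (s + 1) = Ico 1 (s + 1 + 1) from rfl, sum_Ico_eq_sum_range,
    show s + 1 + 1 - 1 = s + 1 by omega]
  refine sum_congr rfl fun o _ => ?_
  rw [add_comm 1 o]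
  ring

/-- **Antisymmetry of the coefficients**: `c_{o,n−p} = (−1)^o c_{o,p}`, i.e.
`(−1)^i a_{i,k} = −a_{i,n−k}`, from `R_n(−t−n) = −R_n(t)` and uniqueness of (2.3).
[cite: LaiYu2020, §2 property (2) ("(−1)^i a_{i,k} = −a_{i,n−k}")] -/
theorem pf_symm {u v s : ℕ} {B : ℝ} {m : ℕ} (hB : 1 ≤ B) (hs : Odd s) (hn : Even (v * m))
    (hM : 1 ≤ (2 * u + v) * m) {c : ℕ → ℕ → ℚ}
    (hc : ∀ t : ℚ, (∀ p : ℕ, p ≤ v * m → t + p + 1 ≠ 0) →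
      pfEval (v * m) (s + 1) c t = R u v s B m (t + 1))
    (o p : ℕ) (ho : o ≤ s) (hp : p ≤ v * m) : c o (v * m - p) = (-1) ^ o * c o p := by
  set n := v * m with hn'
  set e : ℕ → ℕ → ℚ := fun o p => (-1) ^ (o + 1) * c o (n - p) + c o p with he
  have hev : ∀ t : ℕ, 0 ≤ t → pfEval n (s + 1) e t = 0 := by
    intro t _
    have h1 : ∀ p', p' ≤ n → (t : ℚ) + p' + 1 ≠ 0 := fun p' _ => by positivity
    have h2 : ∀ p', p' ≤ n → (-(t : ℚ) - n - 2) + p' + 1 ≠ 0 := by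
      intro p' hp' h0
      have : (p' : ℚ) ≤ n := by exact_mod_cast hp'
      have ht0 : (0 : ℚ) ≤ t := by positivity
      linarith
    have hadd : e = (fun o p => (-1) ^ (o + 1) * c o (n - p)) + c := by
      funext o p; simp [he]
    rw [hadd, pfEval_add, pfEval_reflect, hc _ h2, hc _ h1,
      show -(t : ℚ) - n - 2 + 1 = -((t : ℚ) + 1) - (v : ℚ) * m by rw [hn']; push_cast; ring,
      R_reflect hB hs hn hM]
    ring
  have h := pf_unique n (s + 1) e 0 hev o p (by omega) hp
  simp only [he] at h
  have hsq : ((-1 : ℚ) ^ (o + 1)) * ((-1 : ℚ) ^ (o + 1)) = 1 := by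
    rw [← pow_add, ← two_mul, pow_mul]
    norm_num
  calc c o (n - p) = (((-1 : ℚ) ^ (o + 1)) * ((-1 : ℚ) ^ (o + 1))) * c o (n - p) := by rw [hsq, one_mul]
    _ = (-1) ^ (o + 1) * (-(c o p)) := by rw [mul_assoc, eq_neg_of_add_eq_zero_left h]
    _ = (-1) ^ o * c o p := by ring

/-- **`ρ_i = 0` for even `i`**: `∑_p c_{o,p} = 0` for odd `o ≤ s`.
[cite: LaiYu2020, Lemma 2.5 (only odd i occur)] -/
theorem pf_sum_eq_zero_of_odd {u v s : ℕ} {B : ℝ} {m : ℕ} (hB : 1 ≤ B) (hs : Odd s)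
    (hn : Even (v * m)) (hM : 1 ≤ (2 * u + v) * m) {c : ℕ → ℕ → ℚ}
    (hc : ∀ t : ℚ, (∀ p : ℕ, p ≤ v * m → t + p + 1 ≠ 0) →
      pfEval (v * m) (s + 1) c t = R u v s B m (t + 1))
    (o : ℕ) (ho : o ≤ s) (hoddo : Odd o) : ∑ p ∈ range (v * m + 1), c o p = 0 := by
  have hrefl : ∑ p ∈ range (v * m + 1), c o p = ∑ p ∈ range (v * m + 1), c o (v * m - p) := by
    conv_lhs => rw [← sum_range_reflect]
    refine sum_congr rfl fun p _ => ?_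
    simp
  have hneg : ∑ p ∈ range (v * m + 1), c o (v * m - p) = -∑ p ∈ range (v * m + 1), c o p := by
    rw [← neg_one_mul, mul_sum]
    refine sum_congr rfl fun p hp => ?_
    rw [pf_symm hB hs hn hM hc o p ho (Nat.lt_succ_iff.1 (mem_range.1 hp)), hoddo.neg_one_pow]
  linarith

/-! ### Decay at infinity and `∑_k a_{1,k} = 0` -/

/-- `|P(u)| ≤ (∑_i |coeff_i P|) u^{deg P}` for `u ≥ 1`. [folklore] -/
private theorem abs_eval_le (P : ℚ[X]) {w : ℚ} (hw : 1 ≤ w) :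
    |P.eval w| ≤ (∑ i ∈ range (P.natDegree + 1), |P.coeff i|) * w ^ P.natDegree := by
  rw [eval_eq_sum_range, sum_mul]
  refine (abs_sum_le_sum_abs _ _).trans (sum_le_sum fun i hi => ?_)
  rw [abs_mul, abs_of_nonneg (by positivity : (0 : ℚ) ≤ w ^ i)]
  exact mul_le_mul_of_nonneg_left (pow_le_pow_right₀ hw (by have := mem_range.1 hi; omega))
    (abs_nonneg _)

/-- **Decay of `R_n`** (property (1), `deg R_n ≤ −2`): if `deg Φ_n + 2 ≤ (s+1)(n+1)` then
`|R_n(u)| ≤ C/u²` for `u ≥ 1`. [cite: LaiYu2020, §2 property (1) (deg R_n ≤ −2)] -/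
theorem abs_R_le (u v s : ℕ) (B : ℝ) (m : ℕ)
    (hdeg : 1 + (2 * u + v) * m * (zeroSet_finite B).toFinset.card + 2 ≤ (s + 1) * (v * m + 1)) :
    ∃ C : ℚ, 0 ≤ C ∧ ∀ w : ℚ, 1 ≤ w → |R u v s B m w| ≤ C / w ^ 2 := by
  set Φ : ℚ[X] := C ((A₁pow u v B m : ℚ) * (A₂pow u v B m : ℚ) * ((v * m).factorial : ℚ) ^ (s + 1) /
      ((m.factorial : ℚ) ^ ((2 * u + v) * (zeroSet_finite B).toFinset.card))) *
    ((X - C ((u : ℚ) * m)) * ∏ θ ∈ (zeroSet_finite B).toFinset,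
      ∏ j ∈ range ((2 * u + v) * m), (X - C ((u : ℚ) * m) + C (j : ℚ) + C θ)) with hΦ
  set S : ℚ := ∑ i ∈ range (Φ.natDegree + 1), |Φ.coeff i| with hS
  refine ⟨S, sum_nonneg fun i _ => abs_nonneg _, fun w hw => ?_⟩
  have hw0 : 0 < w := by linarith
  have hD₀ : Φ.natDegree + 2 ≤ (s + 1) * (v * m + 1) :=
    le_trans (Nat.add_le_add_right (natDegree_numerator_le u v s B m) 2) hdeg
  have hden : w ^ (v * m + 1) ≤ ∏ j ∈ range (v * m + 1), (w + j) := by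
    rw [← card_range (v * m + 1), ← prod_const, card_range]
    exact prod_le_prod (fun _ _ => hw0.le) fun j _ => by
      have : (0 : ℚ) ≤ j := by positivity
      linarith
  have hdenpos : 0 < ∏ j ∈ range (v * m + 1), (w + j) := prod_pos fun j _ => by positivity
  rw [R_eq_eval_div, ← hΦ, abs_div, abs_pow, abs_of_pos hdenpos,
    div_le_div_iff₀ (by positivity) (by positivity)]
  have hden' : w ^ ((v * m + 1) * (s + 1)) ≤ (∏ j ∈ range (v * m + 1), (w + j)) ^ (s + 1) := by
    rw [pow_mul]
    exact pow_le_pow_left₀ (by positivity) hden _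
  obtain ⟨e, he⟩ : ∃ e : ℕ, (v * m + 1) * (s + 1) = Φ.natDegree + 2 + e :=
    Nat.exists_eq_add_of_le (by rw [mul_comm]; exact hD₀)
  have hS0 : 0 ≤ S := sum_nonneg fun i _ => abs_nonneg _
  calc |Φ.eval w| * w ^ 2 ≤ S * w ^ Φ.natDegree * w ^ 2 :=
        mul_le_mul_of_nonneg_right (abs_eval_le Φ hw) (by positivity)
    _ = S * (w ^ (Φ.natDegree + 2) * 1) := by ring
    _ ≤ S * (w ^ (Φ.natDegree + 2) * w ^ e) :=
        mul_le_mul_of_nonneg_left (mul_le_mul_of_nonneg_left (one_le_pow₀ hw) (by positivity)) hS0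
    _ = S * w ^ ((v * m + 1) * (s + 1)) := by rw [he, ← pow_add]
    _ ≤ S * (∏ j ∈ range (v * m + 1), (w + j)) ^ (s + 1) := mul_le_mul_of_nonneg_left hden' hS0

/-- **`∑_k a_{1,k} = 0`** (`= lim_{t→∞} t R_n(t)`, the order of `R_n` at infinity is at least `2`).
[cite: LaiYu2020, §2 property (1) with Lemma 2.5 (convergence of r_{n,θ})] -/
theorem pf_sum_zero_eq_zero {u v s : ℕ} {B : ℝ} {m : ℕ}
    (hdeg : 1 + (2 * u + v) * m * (zeroSet_finite B).toFinset.card + 2 ≤ (s + 1) * (v * m + 1))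
    {c : ℕ → ℕ → ℚ}
    (hc : ∀ t : ℚ, (∀ p : ℕ, p ≤ v * m → t + p + 1 ≠ 0) →
      pfEval (v * m) (s + 1) c t = R u v s B m (t + 1)) :
    ∑ p ∈ range (v * m + 1), c 0 p = 0 := by
  set n := v * m with hn
  have hlim1 := tendsto_mul_pfEval n (s + 1) c
  have hval : ∑ p ∈ range (n + 1), ∑ o ∈ range (s + 1), (c o p : ℝ) * (0 : ℝ) ^ o =
      ((∑ p ∈ range (n + 1), c 0 p : ℚ) : ℝ) := by
    push_cast
    refine sum_congr rfl fun p _ => ?_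
    rw [sum_range_succ']
    simp
  rw [hval] at hlim1
  obtain ⟨C, hC0, hC⟩ := abs_R_le u v s B m hdeg
  have hlim2 : Tendsto (fun k : ℕ => (k : ℝ) * (pfEval n (s + 1) c k : ℝ)) atTop (𝓝 0) := by
    have hb : ∀ k : ℕ, |(k : ℝ) * (pfEval n (s + 1) c k : ℝ)| ≤ (C : ℝ) / ((k : ℝ) + 1) := by
      intro k
      have hk' : ∀ p', p' ≤ n → (k : ℚ) + p' + 1 ≠ 0 := fun p' _ => by positivity
      rw [hc k hk']
      have h1 : (1 : ℚ) ≤ k + 1 := by linarith [(Nat.cast_nonneg k : (0 : ℚ) ≤ k)]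
      have hR := hC ((k : ℚ) + 1) h1
      have hR' : |(R u v s B m ((k : ℚ) + 1) : ℝ)| ≤ (C : ℝ) / ((k : ℝ) + 1) ^ 2 := by
        have := (Rat.cast_le (K := ℝ)).2 hR
        push_cast at this
        exact this
      rw [abs_mul, abs_of_nonneg (by positivity : (0 : ℝ) ≤ k)]
      have hk0 : (0 : ℝ) ≤ k := by positivity
      calc (k : ℝ) * |(R u v s B m ((k : ℚ) + 1) : ℝ)| ≤ (k : ℝ) * ((C : ℝ) / ((k : ℝ) + 1) ^ 2) := by gcongr
        _ ≤ ((k : ℝ) + 1) * ((C : ℝ) / ((k : ℝ) + 1) ^ 2) := by gcongr; linarith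
        _ = (C : ℝ) / ((k : ℝ) + 1) := by field_simp
    have hC' : Tendsto (fun k : ℕ => (C : ℝ) / ((k : ℝ) + 1)) atTop (𝓝 0) := by
      have h := (tendsto_one_div_add_atTop_nhds_zero_nat (𝕜 := ℝ)).const_mul (C : ℝ)
      rw [mul_zero] at h
      refine h.congr fun k => ?_
      rw [mul_one_div]
    refine squeeze_zero_norm' ?_ hC'
    exact Eventually.of_forall fun k => by rw [Real.norm_eq_abs]; exact hb k
  have := tendsto_nhds_unique hlim1 hlim2
  exact_mod_cast this

/-! ### Lemma 2.5 -/

/-- **Lai–Yu 2020, Lemma 2.5** (PROVED): for `θ ∈ 𝓕_B` and partial-fraction data `c` of `R_n`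
(`c_{o,p} = a_{o+1,p}`), under the standing hypotheses (`s` odd, `(2r+1)n` even, `B ≥ 1`,
`deg R_n ≤ −2`):
`r_{n,θ} = ∑_{m ≥ 1} R_n(m + θ) = ρ_{0,θ} + ∑_{3 ≤ i ≤ s, i odd} ρ_i ζ(i, θ)` with
`ρ_i = ∑_k a_{i,k}` (independent of `θ`) and `ρ_{0,θ} = −∑_k ∑_{ℓ ≤ k} ∑_{i} a_{i,k}/(ℓ+θ)^i`
(stated as a `HasSum` over `m ≥ 0` of `R_n(m + 1 + θ)`; `ζ(i, θ)` is the tree's `hurwitzValue`).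
[cite: LaiYu2020, Lemma 2.5] -/
theorem lemma25 {u v s : ℕ} {B : ℝ} {m : ℕ} (hB : 1 ≤ B) (hs : Odd s) (hn : Even (v * m))
    (hM : 1 ≤ (2 * u + v) * m)
    (hdeg : 1 + (2 * u + v) * m * (zeroSet_finite B).toFinset.card + 2 ≤ (s + 1) * (v * m + 1))
    {c : ℕ → ℕ → ℚ}
    (hc : ∀ t : ℚ, (∀ p : ℕ, p ≤ v * m → t + p + 1 ≠ 0) →
      pfEval (v * m) (s + 1) c t = R u v s B m (t + 1))
    {θ : ℚ} (hθ : θ ∈ zeroSet B) :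
    HasSum (fun k : ℕ => (R u v s B m ((k : ℚ) + 1 + θ) : ℝ))
      (((-∑ k ∈ range (v * m + 1), ∑ ℓ ∈ range (k + 1), ∑ o ∈ range (s + 1),
          c o k / ((ℓ : ℚ) + θ) ^ (o + 1) : ℚ) : ℝ) +
        ∑ i ∈ (Icc 3 s).filter Odd,
          ((∑ k ∈ range (v * m + 1), c (i - 1) k : ℚ) : ℝ) * hurwitzValue i (θ : ℝ)) := by
  have hθ0 : 0 < θ := ((mem_zeroSet).1 hθ).1
  have h := hasSum_pfEval_shift (n := v * m) hs (pf_sum_zero_eq_zero hdeg hc)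
    (fun o ho hoddo => pf_sum_eq_zero_of_odd hB hs hn hM hc o ho hoddo) hθ0
  refine h.congr_fun fun k => ?_
  have hk : ∀ p : ℕ, p ≤ v * m → (k : ℚ) + θ + p + 1 ≠ 0 := fun p _ => by positivity
  rw [hc _ hk, show (k : ℚ) + θ + 1 = (k : ℚ) + 1 + θ by ring]

end Literature.NumberTheory.Irrationality.LaiYu2020

end
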